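import Summits.QuantumFields.BalabanUV.T4Continuum.Support.VariationalColourTwoRunsTaxiEnd
import Summits.QuantumFields.BalabanUV.T4Continuum.Support.VariationalColourConstantCurvatureTower
import Summits.QuantumFields.BalabanUV.T4Continuum.Support.VariationalVectorEndFlatMin

/-!
# T⁴ programme, spine node NE2 (U1a), lane P2 — SUPPLIER ITEM «V-COL-TWO-RUNS», file 5: A NON-ABELIAN INHABITANT OF THE TWO-RUNS END — the constant non-commuting SU(2)
# towers with a DRIFTING angle `θ_r` along the runs (`|θ_{r+1} − θ_r| ≤ ε·t^r`): genuinely different, non-flat, non-abelian runs for which EVERY hypothesis of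
# `towerLimitRate_colourTwoRunsTaxi` is a theorem except the numeric smallness lines (model level; cell `pub-balaban`)

NE2 formalisation swarm `b2b-balaban-t4-ne2-formalise-*`, leaf prover 02 (gen 6); register P2-sup, item «V-COL-TWO-RUNS» file 5 (INTENT CLAIMS.log l.17982 + addenda).
Composition BY NAME of file 4 `VariationalColourTwoRunsTaxiEnd.towerLimitRate_colourTwoRunsTaxi` with «V-COL-TAXI-0FORM-END» file 3's SU(2) tower
(`VariationalColourConstantCurvatureTower.{rotX, rotZ, Jm, toOp, ccBond, ccTower, rotX_mul, rotX_mem_unitary, toOp_mem_unitary, ccTower_mem_unitary, ccTower_coherent,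
ccBond_comm_le}`, p228018).
 * §1 the Pauli matrices `sigmaX`, `sigmaZ` (unitary) and the HALF-ANGLE IDENTITIES `rotX (2h) − 1 = rotX h · ((2 sin h · i) • σ_x)`, `rotZ (2h) − 1 = rotZ h · ((2 sin h · i) • σ_z)`,
   hence **`norm_toOp_rotX_sub_le`** ∕ `norm_toOp_rotZ_sub_le`: `‖exp(iaσ) − exp(ia′σ)‖ ≤ |a − a′|` as operators on `ℂ²`;
 * §2 **`ccBond_sub_le`**: two constant towers with angles `(θ, φ)` and `(θ′, φ)` have level-`j` one-step bond fields within `|θ − θ′|∕L^{j+1}`;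
 * §3 **`towerLimitRate_colourTwoRunsConstantCurvature`**: runs `r ↦ ccTower (θs r) φ μ₀ μ₁` with `|θs r| ≤ Θ` (common plaquette class `c = 2Θ|φ|`) and DRIFT
   `|θs (k+1) − θs k| ≤ ε·t^k`, `0 ≤ t < 1` ⟹ file 4's END holds with `σ k j = |θs (k+1) − θs k|∕L^{j+1}`, `c_ρ = ε`, `c_τ = d·ε`: the run-diagonal colour effective operators
   converge at rate `max(L⁻¹, t)`; displayed: the two numeric smallness lines at `c = 2Θ|φ|`, `2 ≤ L`, `1 < M_μ`, `0 < a₀`.  With `ccBond_not_comm` (file 3 of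
   «V-COL-TAXI-0FORM-END») the runs are NOT flat and, for `θs` non-constant, NOT equal — the two-runs END's hypothesis set is inhabited non-trivially and non-abelianly;
 * §4 the ENDs UNPACKED (`TowerLimitRate` with identity averagings, leaf-10-g3's `avgTow_const_one` BY NAME): **`colourConstantCurvature_limit`** (one SU(2) tower:
   `∃ X∞, X_k → X∞` with `‖X_k − X∞‖ ≤ C·L^{−k}∕(1 − L⁻¹)`) and **`colourTwoRunsConstantCurvature_limit`** (drifting runs: `‖X_k − X∞‖ ≤ C·ρ₀^k∕(1 − ρ₀)`, `ρ₀ = max(L⁻¹, t)`).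

HONEST FRAMING (T4-DAG p. 1).  A non-vacuity WITNESS at MODEL level for OUR typed objects (no identification with Bałaban's runs `U_k`, c5, no B0); the drift class stands in for
node NE3's currency only FORMALLY (nothing of NE3 is asserted); [folklore] 2×2 algebra + files BY NAME; nothing printed is a hypothesis; data defs `sigmaX` ∕ `sigmaZ` only, no
`def … : Prop`, no `sorry`; axioms standard.  NE2 NOT proved on either road; NE3 OPEN; spine PROVED 0∕9; rung (B)+1 finite T⁴ — NOT infinite volume, NOT mass gap, NOT Clay.
HONEST DEPENDENCY (cell, verbatim): continuum YM on T⁴ ⇐ BetaPertH ∧ nine spine estimates (0/9 proved); BetaPertH ⇐ (D1) ∧ (D4) ∧ CAP+tail; G-an2-4 gates asym, D1 and NE2/3/4.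
-/

noncomputable section

namespace Summit.QuantumFields.BalabanUV.T4Continuum.VariationalColourTwoRunsConstantCurvature

open Complex
open scoped Matrix Matrix.Norms.L2Operator
open Literature.MathematicalPhysics.QuantumFieldTheory.Balaban1983to89
open Literature.MathematicalPhysics.QuantumFieldTheory.Balaban1983to89.B5Prop11Plancherel (Tor fine unitVec)
open Summit.QuantumFields.BalabanUV.T4Continuum.CovariantAveragingTower (TowerLimitRate avgTow)
open Summit.QuantumFields.BalabanUV.T4Continuum.VariationalColourFederbush (norm_le_one_of_mem_unitary)
open Summit.QuantumFields.BalabanUV.T4Continuum.VariationalColourTaxiTransport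
open Summit.QuantumFields.BalabanUV.T4Continuum.VariationalEffectiveHilbertPairs (effC)
open Summit.QuantumFields.BalabanUV.T4Continuum.VariationalVectorEndOfLeaves (eV ePV)
open Summit.QuantumFields.BalabanUV.T4Continuum.VariationalColourConstantCurvatureTower
open Summit.QuantumFields.BalabanUV.T4Continuum.VariationalColourTwoRunsTaxiEnd (towerLimitRate_colourTwoRunsTaxi)
open Summit.QuantumFields.BalabanUV.T4Continuum.VariationalColourNestedTaxiEnd (towerLimitRate_colourTaxiTower)
open Summit.QuantumFields.BalabanUV.T4Continuum.VariationalVectorEndFlatMin (avgTow_const_one)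
open Filter Topology

/-! ## §1 Pauli matrices and the half-angle identities -/

section Matrices

/-- `σ_x`. [folklore] -/
def sigmaX : Matrix (Fin 2) (Fin 2) ℂ := !![0, 1; 1, 0]

/-- `σ_z`. [folklore] -/
def sigmaZ : Matrix (Fin 2) (Fin 2) ℂ := !![1, 0; 0, -1]

/-- `exp(2ihσ_x) − 1 = exp(ihσ_x)·(2i sin h)σ_x`. [folklore] -/
theorem rotX_two_mul_sub_one (h : ℝ) : rotX (2 * h) - 1 = rotX h * ((((2 * Real.sin h : ℝ) : ℂ) * I) • sigmaX) := by
  ext i j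
  fin_cases i <;> fin_cases j
  · simp [rotX, sigmaX, Matrix.mul_apply, Fin.sum_univ_two, Real.cos_two_mul]
    linear_combination (-2 * (Complex.sin h) ^ 2) * Complex.I_sq + (2 : ℂ) * Complex.cos_sq_add_sin_sq (h : ℂ)
  · simp [rotX, sigmaX, Matrix.mul_apply, Fin.sum_univ_two, Real.sin_two_mul]
    ring
  · simp [rotX, sigmaX, Matrix.mul_apply, Fin.sum_univ_two, Real.sin_two_mul]
    ring
  · simp [rotX, sigmaX, Matrix.mul_apply, Fin.sum_univ_two, Real.cos_two_mul]
    linear_combination (-2 * (Complex.sin h) ^ 2) * Complex.I_sq + (2 : ℂ) * Complex.cos_sq_add_sin_sq (h : ℂ)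

/-- `exp(2ihσ_z) − 1 = exp(ihσ_z)·(2i sin h)σ_z`. [folklore] -/
theorem rotZ_two_mul_sub_one (h : ℝ) : rotZ (2 * h) - 1 = rotZ h * ((((2 * Real.sin h : ℝ) : ℂ) * I) • sigmaZ) := by
  ext i j
  fin_cases i <;> fin_cases j
  · simp [rotZ, sigmaZ, Matrix.mul_apply, Fin.sum_univ_two, Real.cos_two_mul, Real.sin_two_mul]
    linear_combination (-2 * (Complex.sin h) ^ 2) * Complex.I_sq + (2 : ℂ) * Complex.cos_sq_add_sin_sq (h : ℂ)
  · simp [rotZ, sigmaZ]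
  · simp [rotZ, sigmaZ]
  · simp [rotZ, sigmaZ, Matrix.mul_apply, Fin.sum_univ_two, Real.cos_two_mul, Real.sin_two_mul]
    linear_combination (-2 * (Complex.sin h) ^ 2) * Complex.I_sq + (2 : ℂ) * Complex.cos_sq_add_sin_sq (h : ℂ)

/-- `σ_x` is unitary. [folklore] -/
theorem sigmaX_mem_unitary : sigmaX ∈ unitary (Matrix (Fin 2) (Fin 2) ℂ) := by
  refine Unitary.mem_iff.mpr ⟨?_, ?_⟩ <;>
  · rw [Matrix.star_eq_conjTranspose]
    ext i j
    fin_cases i <;> fin_cases j <;> simp [sigmaX, Matrix.mul_apply, Fin.sum_univ_two, Matrix.conjTranspose_apply]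

/-- `σ_z` is unitary. [folklore] -/
theorem sigmaZ_mem_unitary : sigmaZ ∈ unitary (Matrix (Fin 2) (Fin 2) ℂ) := by
  refine Unitary.mem_iff.mpr ⟨?_, ?_⟩ <;>
  · rw [Matrix.star_eq_conjTranspose]
    ext i j
    fin_cases i <;> fin_cases j <;> simp [sigmaZ, Matrix.mul_apply, Fin.sum_univ_two, Matrix.conjTranspose_apply]

/-- the scalar `2 sin((a − a′)∕2)·i` has modulus `≤ |a − a′|`. [folklore] -/
theorem norm_two_sin_half_le (a a' : ℝ) : ‖(((2 * Real.sin ((a - a') / 2) : ℝ) : ℂ) * I)‖ ≤ |a - a'| := by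
  rw [norm_mul, Complex.norm_I, mul_one, Complex.norm_real, Real.norm_eq_abs, abs_mul, abs_two]
  have := Real.abs_sin_le_abs (x := (a - a') / 2)
  have e : |a - a'| = 2 * |(a - a') / 2| := by rw [abs_div, abs_two]; ring
  rw [e]; linarith

/-- **one-parameter groups are 1-Lipschitz in the angle**: `‖exp(iaσ_x) − exp(ia′σ_x)‖ ≤ |a − a′|` as operators on `ℂ²`. [folklore] -/
theorem norm_toOp_rotX_sub_le (a a' : ℝ) : ‖toOp (rotX a) - toOp (rotX a')‖ ≤ |a - a'| := by
  have hfac : rotX a - rotX a' = rotX a' * (rotX (a - a') - 1) := by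
    rw [mul_sub, mul_one, rotX_mul]; ring_nf
  have h2 : rotX (a - a') - 1 = rotX ((a - a') / 2) * ((((2 * Real.sin ((a - a') / 2) : ℝ) : ℂ) * I) • sigmaX) := by
    rw [← rotX_two_mul_sub_one]; ring_nf
  rw [← map_sub, hfac, h2, map_mul, map_mul, map_smul]
  have hu1 : ‖toOp (rotX a')‖ ≤ 1 := norm_le_one_of_mem_unitary (toOp_mem_unitary (rotX_mem_unitary _))
  have hu2 : ‖toOp (rotX ((a - a') / 2))‖ ≤ 1 := norm_le_one_of_mem_unitary (toOp_mem_unitary (rotX_mem_unitary _))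
  have hu3 : ‖toOp sigmaX‖ ≤ 1 := norm_le_one_of_mem_unitary (toOp_mem_unitary sigmaX_mem_unitary)
  have hs := norm_two_sin_half_le a a'
  calc ‖toOp (rotX a') * (toOp (rotX ((a - a') / 2)) * ((((2 * Real.sin ((a - a') / 2) : ℝ) : ℂ) * I) • toOp sigmaX))‖
      ≤ ‖toOp (rotX a')‖ * (‖toOp (rotX ((a - a') / 2))‖ * (‖(((2 * Real.sin ((a - a') / 2) : ℝ) : ℂ) * I)‖ * ‖toOp sigmaX‖)) := by
        refine (norm_mul_le _ _).trans (mul_le_mul_of_nonneg_left ?_ (norm_nonneg _))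
        refine (norm_mul_le _ _).trans (mul_le_mul_of_nonneg_left ?_ (norm_nonneg _))
        rw [norm_smul]
    _ ≤ 1 * (1 * (|a - a'| * 1)) := by gcongr
    _ = |a - a'| := by ring

/-- `‖exp(iaσ_z) − exp(ia′σ_z)‖ ≤ |a − a′|`. [folklore] -/
theorem norm_toOp_rotZ_sub_le (a a' : ℝ) : ‖toOp (rotZ a) - toOp (rotZ a')‖ ≤ |a - a'| := by
  have hfac : rotZ a - rotZ a' = rotZ a' * (rotZ (a - a') - 1) := by
    rw [mul_sub, mul_one, rotZ_mul]; ring_nf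
  have h2 : rotZ (a - a') - 1 = rotZ ((a - a') / 2) * ((((2 * Real.sin ((a - a') / 2) : ℝ) : ℂ) * I) • sigmaZ) := by
    rw [← rotZ_two_mul_sub_one]; ring_nf
  rw [← map_sub, hfac, h2, map_mul, map_mul, map_smul]
  have hu1 : ‖toOp (rotZ a')‖ ≤ 1 := norm_le_one_of_mem_unitary (toOp_mem_unitary (rotZ_mem_unitary _))
  have hu2 : ‖toOp (rotZ ((a - a') / 2))‖ ≤ 1 := norm_le_one_of_mem_unitary (toOp_mem_unitary (rotZ_mem_unitary _))
  have hu3 : ‖toOp sigmaZ‖ ≤ 1 := norm_le_one_of_mem_unitary (toOp_mem_unitary sigmaZ_mem_unitary)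
  have hs := norm_two_sin_half_le a a'
  calc ‖toOp (rotZ a') * (toOp (rotZ ((a - a') / 2)) * ((((2 * Real.sin ((a - a') / 2) : ℝ) : ℂ) * I) • toOp sigmaZ))‖
      ≤ ‖toOp (rotZ a')‖ * (‖toOp (rotZ ((a - a') / 2))‖ * (‖(((2 * Real.sin ((a - a') / 2) : ℝ) : ℂ) * I)‖ * ‖toOp sigmaZ‖)) := by
        refine (norm_mul_le _ _).trans (mul_le_mul_of_nonneg_left ?_ (norm_nonneg _))
        refine (norm_mul_le _ _).trans (mul_le_mul_of_nonneg_left ?_ (norm_nonneg _))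
        rw [norm_smul]
    _ ≤ 1 * (1 * (|a - a'| * 1)) := by gcongr
    _ = |a - a'| := by ring

end Matrices

/-! ## §2 Two constant towers with different `σ_x`-angles -/

section Bonds

variable {d : ℕ} (θ θ' φ : ℝ) (μ₀ μ₁ : Fin d) (L : ℕ) [NeZero L]

/-- **two constant towers with angles `θ`, `θ′` along `μ₀` (same `φ` along `μ₁`) have level-`k` bond fields within `|θ − θ′|∕L^{k+1}`**. [folklore] -/
theorem ccBond_sub_le (k : ℕ) (μ : Fin d) :
    ‖ccBond θ φ μ₀ μ₁ L k μ - ccBond θ' φ μ₀ μ₁ L k μ‖ ≤ |θ - θ'| / (L : ℝ) ^ (k + 1) := by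
  have hL0 : (0 : ℝ) < (L : ℝ) ^ (k + 1) := by have := NeZero.ne L; positivity
  unfold ccBond
  split_ifs
  · refine (norm_toOp_rotX_sub_le _ _).trans (le_of_eq ?_)
    rw [← sub_div, abs_div, abs_of_pos hL0]
  · rw [sub_self, norm_zero]; positivity
  · rw [sub_self, norm_zero]; positivity

end Bonds

/-! ## §3 The two-runs END at the drifting SU(2) towers -/

section End

variable {d : ℕ} (L : ℕ) [NeZero L] (M : Fin d → ℕ) [hM : ∀ μ, NeZero (M μ)]

/-- **THE COLOUR 0-FORM TWO-RUNS END IN A DRIFTING CONSTANT NON-ABELIAN BACKGROUND.**  Runs `r ↦ ccTower (θs r) φ μ₀ μ₁` (`μ₀ ≠ μ₁`, `|θs r| ≤ Θ`, drift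
`|θs (k+1) − θs k| ≤ ε·t^k`, `0 ≤ t < 1`): file 4's `towerLimitRate_colourTwoRunsTaxi` with unitarity, the plaquette class `c = 2Θ|φ|`, coherence AND the two-run class on the
bond fields (`σ k j = |θs (k+1) − θs k|∕L^{j+1}`, `c_ρ = ε`, `c_τ = d·ε`) ALL THEOREMS; displayed: the two numeric smallness lines at `c = 2Θ|φ|`, `2 ≤ L`, `1 < M_μ`, `0 < a₀`.
Model level; a non-vacuity witness; NE2 NOT proved. [folklore] -/
theorem towerLimitRate_colourTwoRunsConstantCurvature (hL : 2 ≤ L) (hM2 : ∀ μ, 1 < M μ) {μ₀ μ₁ : Fin d} (hne : μ₀ ≠ μ₁) (θs : ℕ → ℝ) (φ Θ : ℝ)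
    (hΘ : ∀ r, |θs r| ≤ Θ) {ε t : ℝ} (ht0 : 0 ≤ t) (ht1 : t < 1) (hdrift : ∀ k, |θs (k + 1) - θs k| ≤ ε * t ^ k)
    (hc₁ : 64 * (d : ℝ) * (((d - 1 : ℕ) : ℝ) * (2 * Θ * |φ|)) ^ 2 ≤ 1 / 2)
    (hc₂ : 2 * (d : ℝ) * (((d - 1 : ℕ) : ℝ) * (2 * Θ * |φ|)) ^ 2 + 4 * (((((d - 1 : ℕ) : ℝ) + (d : ℝ) * d) * (2 * Θ * |φ|))) ^ 2 ≤ 1 / 2)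
    {a₀ : ℝ} (ha₀ : 0 < a₀) :
    let c : ℝ := 2 * Θ * |φ|
    let cw : ℝ := (4 + ((d - 1 : ℕ) : ℝ) * c) / (1 - (((d - 1 : ℕ) : ℝ) + (d : ℝ) * d) * c)
    let cm : ℝ := ((d - 1 : ℕ) : ℝ) * c
    let c₁ : ℝ := 2 * ((d - 1 : ℕ) : ℝ) * c
    let Λcs : ℝ := 2 * d * (36 : ℝ) ^ d * ((1 + cw) ^ 2 + 9)
    let CRs : ℝ := 2 * Λcs + 2 * d * c + (d : ℝ) ^ 2 * c ^ 2 * 136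
    let cε : ℝ := ((d : ℝ) / 4 + 1 / 2) * L
    let cδ' : ℝ := Real.sqrt (2 * d * (1 + (d : ℝ) ^ 2)) * ((L : ℝ) * c₁)
    let Λs : ℝ := Λcs + (cε * CRs + 2 * cδ' * Real.sqrt ((1 + cε * CRs) * 136) + cδ' ^ 2 * 136) * (Λcs + 1)
    TowerLimitRate (ι := fun _ => Tor M × Fin 2) (fun _ => (1 : Matrix (Tor M × Fin 2) (Tor M × Fin 2) ℂ)) 1
      (fun k => effC (L ^ k) M (coarseTv L (fine (L ^ k) M) (ccTower (θs k) φ μ₀ μ₁ L M k)) (nestTv L M (ccTower (θs k) φ μ₀ μ₁ L M) k)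
        (EuclideanSpace.basisFun (Fin 2) ℂ) a₀)
      (eV Λs 136 (Real.sqrt d * cm) + ePV Λs 136 CRs cε cδ' + eV Λcs 136 (Real.sqrt d * ε + Real.sqrt Λcs * ((d : ℝ) * ε))) (max ((L : ℝ)⁻¹) t) := by
  intro c cw cm c₁ Λcs CRs cε cδ' Λs
  have hd : 1 ≤ d := Nat.one_le_iff_ne_zero.mpr (fun h => by subst h; exact Fin.elim0 μ₀)
  have hL1 : (1 : ℝ) ≤ L := by exact_mod_cast (show 1 ≤ L by omega)
  have hLpos : ∀ k : ℕ, (0 : ℝ) < (L : ℝ) ^ (k + 1) := fun k => by positivity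
  have hΘ0 : 0 ≤ Θ := (abs_nonneg _).trans (hΘ 0)
  -- the common plaquette class of every run
  have hclass : ∀ k, ((((L ^ k : ℕ)) : ℝ) * L) ^ 2 * (2 * Θ * |φ| / ((L : ℝ) ^ (k + 1)) ^ 2) ≤ c := fun k => by
    have e : ((((L ^ k : ℕ)) : ℝ) * L) = (L : ℝ) ^ (k + 1) := by push_cast; rw [pow_succ]
    rw [e, mul_div_assoc', mul_div_cancel_left₀ _ (pow_ne_zero 2 (hLpos k).ne')]
  have hb : ∀ r k x κ ι, ‖ccTower (θs r) φ μ₀ μ₁ L M k x κ * ccTower (θs r) φ μ₀ μ₁ L M k (x + unitVec (fine L (fine (L ^ k) M)) κ) ι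
      - ccTower (θs r) φ μ₀ μ₁ L M k x ι * ccTower (θs r) φ μ₀ μ₁ L M k (x + unitVec (fine L (fine (L ^ k) M)) ι) κ‖ ≤ 2 * Θ * |φ| / ((L : ℝ) ^ (k + 1)) ^ 2 :=
    fun r k x κ ι => (ccBond_comm_le (θs r) φ μ₀ μ₁ L hne k κ ι).trans (by
      have := hΘ r
      have h0 : 0 ≤ |φ| / ((L : ℝ) ^ (k + 1)) ^ 2 := by positivity
      calc 2 * |θs r| * |φ| / ((L : ℝ) ^ (k + 1)) ^ 2 = 2 * |θs r| * (|φ| / ((L : ℝ) ^ (k + 1)) ^ 2) := by ring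
        _ ≤ 2 * Θ * (|φ| / ((L : ℝ) ^ (k + 1)) ^ 2) := by nlinarith
        _ = 2 * Θ * |φ| / ((L : ℝ) ^ (k + 1)) ^ 2 := by ring)
  -- the two-run class on the bond fields from the drift
  have hσ : ∀ k j x μ, ‖ccTower (θs (k + 1)) φ μ₀ μ₁ L M j x μ - ccTower (θs k) φ μ₀ μ₁ L M j x μ‖ ≤ |θs (k + 1) - θs k| / (L : ℝ) ^ (j + 1) :=
    fun k j x μ => ccBond_sub_le (θs (k + 1)) (θs k) φ μ₀ μ₁ L j μ
  have hρc : ∀ k, (((L ^ k : ℕ)) : ℝ) * ((L : ℝ) * (|θs (k + 1) - θs k| / (L : ℝ) ^ (k + 1))) ≤ ε * t ^ k := fun k => by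
    have e : (((L ^ k : ℕ)) : ℝ) * ((L : ℝ) * (|θs (k + 1) - θs k| / (L : ℝ) ^ (k + 1))) = |θs (k + 1) - θs k| := by
      push_cast
      rw [pow_succ]
      field_simp
    rw [e]; exact hdrift k
  have hτc : ∀ k, ∑ j ∈ Finset.range k, (d : ℝ) * (((L - 1 : ℕ) : ℝ) * (|θs (k + 1) - θs k| / (L : ℝ) ^ (j + 1))) ≤ (d : ℝ) * ε * t ^ k := fun k => by
    have hL1' : ((L - 1 : ℕ) : ℝ) = (L : ℝ) - 1 := by rw [Nat.cast_sub (by omega), Nat.cast_one]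
    -- `Σ_{j<k} (L−1)∕L^{j+1} = 1 − L^{−k} ≤ 1`
    have hgeom : ∑ j ∈ Finset.range k, ((L : ℝ) - 1) / (L : ℝ) ^ (j + 1) ≤ 1 := by
      have hterm : ∀ j ∈ Finset.range k, ((L : ℝ) - 1) / (L : ℝ) ^ (j + 1) = ((L : ℝ)⁻¹) ^ j - ((L : ℝ)⁻¹) ^ (j + 1) := fun j _ => by
        have hL0 : (L : ℝ) ≠ 0 := by positivity
        rw [pow_succ, inv_pow, inv_pow, pow_succ]
        field_simp
      rw [Finset.sum_congr rfl hterm, Finset.sum_range_sub', pow_zero]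
      have : 0 ≤ ((L : ℝ)⁻¹) ^ k := by positivity
      linarith
    have hΔ0 : 0 ≤ |θs (k + 1) - θs k| := abs_nonneg _
    calc ∑ j ∈ Finset.range k, (d : ℝ) * (((L - 1 : ℕ) : ℝ) * (|θs (k + 1) - θs k| / (L : ℝ) ^ (j + 1)))
        = (d : ℝ) * |θs (k + 1) - θs k| * ∑ j ∈ Finset.range k, ((L : ℝ) - 1) / (L : ℝ) ^ (j + 1) := by
          rw [Finset.mul_sum]; refine Finset.sum_congr rfl fun j _ => ?_; rw [hL1']; ring
      _ ≤ (d : ℝ) * |θs (k + 1) - θs k| * 1 := mul_le_mul_of_nonneg_left hgeom (by positivity)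
      _ ≤ (d : ℝ) * (ε * t ^ k) * 1 := by gcongr; exact hdrift k
      _ = (d : ℝ) * ε * t ^ k := by ring
  exact towerLimitRate_colourTwoRunsTaxi L M hd hL hM2 (fun r => ccTower_mem_unitary (θs r) φ μ₀ μ₁ L M)
    (b := fun k => 2 * Θ * |φ| / ((L : ℝ) ^ (k + 1)) ^ 2) (fun k => by positivity) hb
    (fun r => ccTower_coherent (θs r) φ μ₀ μ₁ L M) hclass hc₁ hc₂
    (fun k j => |θs (k + 1) - θs k| / (L : ℝ) ^ (j + 1)) (fun k j => by positivity) hσ ht0 ht1 hρc hτc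
    (EuclideanSpace.basisFun (Fin 2) ℂ) ha₀

/-! ## §4 The ENDs unpacked: existence of the limit with the explicit rate -/

/-- **THE COLOUR 0-FORM LIMIT IN A CONSTANT NON-ABELIAN BACKGROUND, UNPACKED**: under the hypotheses of `towerLimitRate_colourConstantCurvature` there is `X∞` with
`X_k → X∞` and `‖X_k − X∞‖ ≤ C·(L⁻¹)^k∕(1 − L⁻¹)`, `X_k = effC (L^k) M (coarseTv (ccTower θ φ μ₀ μ₁ k)) (nestTv (ccTower θ φ μ₀ μ₁) k) (basisFun) a₀`, `C` the END's constant. [folklore] -/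
theorem colourConstantCurvature_limit (hL : 2 ≤ L) (hM2 : ∀ μ, 1 < M μ) {μ₀ μ₁ : Fin d} (hne : μ₀ ≠ μ₁) (θ φ : ℝ)
    (hc₁ : 64 * (d : ℝ) * (((d - 1 : ℕ) : ℝ) * (2 * |θ| * |φ|)) ^ 2 ≤ 1 / 2)
    (hc₂ : 2 * (d : ℝ) * (((d - 1 : ℕ) : ℝ) * (2 * |θ| * |φ|)) ^ 2 + 4 * (((((d - 1 : ℕ) : ℝ) + (d : ℝ) * d) * (2 * |θ| * |φ|))) ^ 2 ≤ 1 / 2)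
    {a₀ : ℝ} (ha₀ : 0 < a₀) :
    ∃ (C : ℝ) (Xlim : Matrix (Tor M × Fin 2) (Tor M × Fin 2) ℂ),
      Tendsto (fun k => effC (L ^ k) M (coarseTv L (fine (L ^ k) M) (ccTower θ φ μ₀ μ₁ L M k)) (nestTv L M (ccTower θ φ μ₀ μ₁ L M) k)
        (EuclideanSpace.basisFun (Fin 2) ℂ) a₀) atTop (𝓝 Xlim) ∧
      ∀ k, ‖effC (L ^ k) M (coarseTv L (fine (L ^ k) M) (ccTower θ φ μ₀ μ₁ L M k)) (nestTv L M (ccTower θ φ μ₀ μ₁ L M) k)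
        (EuclideanSpace.basisFun (Fin 2) ℂ) a₀ - Xlim‖ ≤ C * ((L : ℝ)⁻¹) ^ k / (1 - (L : ℝ)⁻¹) := by
  obtain ⟨Xlim, hT, hR⟩ := towerLimitRate_colourConstantCurvature L M hL hM2 hne θ φ hc₁ hc₂ ha₀
  have e : avgTow (ι := fun _ => Tor M × Fin 2) (fun _ => (1 : Matrix (Tor M × Fin 2) (Tor M × Fin 2) ℂ)) 1
      (fun k => effC (L ^ k) M (coarseTv L (fine (L ^ k) M) (ccTower θ φ μ₀ μ₁ L M k)) (nestTv L M (ccTower θ φ μ₀ μ₁ L M) k)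
        (EuclideanSpace.basisFun (Fin 2) ℂ) a₀)
      = fun k => effC (L ^ k) M (coarseTv L (fine (L ^ k) M) (ccTower θ φ μ₀ μ₁ L M k)) (nestTv L M (ccTower θ φ μ₀ μ₁ L M) k)
        (EuclideanSpace.basisFun (Fin 2) ℂ) a₀ := funext fun k => avgTow_const_one _ k
  rw [e] at hT hR
  exact ⟨_, Xlim, hT, hR⟩

/-- **THE DRIFTING-RUNS LIMIT, UNPACKED**: under the hypotheses of `towerLimitRate_colourTwoRunsConstantCurvature` there is `X∞` with the run-diagonal `X_k → X∞` and
`‖X_k − X∞‖ ≤ C·ρ₀^k∕(1 − ρ₀)`, `ρ₀ = max(L⁻¹, t)`. [folklore] -/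
theorem colourTwoRunsConstantCurvature_limit (hL : 2 ≤ L) (hM2 : ∀ μ, 1 < M μ) {μ₀ μ₁ : Fin d} (hne : μ₀ ≠ μ₁) (θs : ℕ → ℝ) (φ Θ : ℝ)
    (hΘ : ∀ r, |θs r| ≤ Θ) {ε t : ℝ} (ht0 : 0 ≤ t) (ht1 : t < 1) (hdrift : ∀ k, |θs (k + 1) - θs k| ≤ ε * t ^ k)
    (hc₁ : 64 * (d : ℝ) * (((d - 1 : ℕ) : ℝ) * (2 * Θ * |φ|)) ^ 2 ≤ 1 / 2)
    (hc₂ : 2 * (d : ℝ) * (((d - 1 : ℕ) : ℝ) * (2 * Θ * |φ|)) ^ 2 + 4 * (((((d - 1 : ℕ) : ℝ) + (d : ℝ) * d) * (2 * Θ * |φ|))) ^ 2 ≤ 1 / 2)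
    {a₀ : ℝ} (ha₀ : 0 < a₀) :
    ∃ (C : ℝ) (Xlim : Matrix (Tor M × Fin 2) (Tor M × Fin 2) ℂ),
      Tendsto (fun k => effC (L ^ k) M (coarseTv L (fine (L ^ k) M) (ccTower (θs k) φ μ₀ μ₁ L M k)) (nestTv L M (ccTower (θs k) φ μ₀ μ₁ L M) k)
        (EuclideanSpace.basisFun (Fin 2) ℂ) a₀) atTop (𝓝 Xlim) ∧
      ∀ k, ‖effC (L ^ k) M (coarseTv L (fine (L ^ k) M) (ccTower (θs k) φ μ₀ μ₁ L M k)) (nestTv L M (ccTower (θs k) φ μ₀ μ₁ L M) k)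
        (EuclideanSpace.basisFun (Fin 2) ℂ) a₀ - Xlim‖ ≤ C * (max ((L : ℝ)⁻¹) t) ^ k / (1 - max ((L : ℝ)⁻¹) t) := by
  obtain ⟨Xlim, hT, hR⟩ := towerLimitRate_colourTwoRunsConstantCurvature L M hL hM2 hne θs φ Θ hΘ ht0 ht1 hdrift hc₁ hc₂ ha₀
  have e : avgTow (ι := fun _ => Tor M × Fin 2) (fun _ => (1 : Matrix (Tor M × Fin 2) (Tor M × Fin 2) ℂ)) 1
      (fun k => effC (L ^ k) M (coarseTv L (fine (L ^ k) M) (ccTower (θs k) φ μ₀ μ₁ L M k)) (nestTv L M (ccTower (θs k) φ μ₀ μ₁ L M) k)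
        (EuclideanSpace.basisFun (Fin 2) ℂ) a₀)
      = fun k => effC (L ^ k) M (coarseTv L (fine (L ^ k) M) (ccTower (θs k) φ μ₀ μ₁ L M k)) (nestTv L M (ccTower (θs k) φ μ₀ μ₁ L M) k)
        (EuclideanSpace.basisFun (Fin 2) ℂ) a₀ := funext fun k => avgTow_const_one _ k
  rw [e] at hT hR
  exact ⟨_, Xlim, hT, hR⟩

end End

end Summit.QuantumFields.BalabanUV.T4Continuum.VariationalColourTwoRunsConstantCurvature

end
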